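import Mathlib
import Summits.Ventures.PercRepro.TriangleCapDenseStabilityReduction

/-!
# PercRepro — the one-triangle case of the dense-corner stability, part A: far pairs, private neighbourhoods,
the partition, and `|T₃| ≤ 6` when every triangle is `{u, v, w}` (p3, gen 34; part 33a)

Bookkeeping for TriangleCapOneTriangle: `far D z` = the ordered adjacent pairs with both ends non-adjacent to `z`
(`sum_deficit_eq_sum_far`: the deficit sum is the far-pair sum); `priv D a b c` = the neighbours of `a` adjacent to
neither `b` nor `c` (the private neighbourhood of `a` in a triangle `a b c`); `outer D u v w` = the vertices adjacent
to none of `u, v, w`; the partition of the vertices around a triangle of a `K₄⁻`-free graph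
(`card_partition_triangle`); and `card_triangles3_le_six` when every triangle vertex lies in `{u, v, w}`.
Axioms: standard.
-/

namespace PercRepro

namespace TriangleCap

namespace C047

open Finset

variable {V : Type*} [Fintype V] [DecidableEq V]

omit [DecidableEq V] in
/-- The far pairs of `z`: ordered adjacent pairs with both ends non-adjacent to `z`. -/
def far (D : SimpleGraph V) [DecidableRel D.Adj] (z : V) : ℕ :=
  ((adjPairsAll D).filter (fun p => ¬ D.Adj p.1 z ∧ ¬ D.Adj p.2 z)).card

omit [DecidableEq V] in
/-- The deficit sum over the ordered adjacent pairs is the far-pair sum over the vertices. -/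
theorem sum_deficit_eq_sum_far (D : SimpleGraph V) [DecidableRel D.Adj] :
    ∑ p ∈ adjPairsAll D, deficit D p = ∑ z, far D z := by
  unfold deficit far
  simp only [card_filter]
  rw [sum_comm]

omit [DecidableEq V] in
/-- The private neighbourhood of `a` with respect to `b, c`: adjacent to `a`, to neither `b` nor `c`. -/
def priv (D : SimpleGraph V) [DecidableRel D.Adj] (a b c : V) : Finset V :=
  univ.filter (fun x => D.Adj a x ∧ ¬ D.Adj b x ∧ ¬ D.Adj c x)

omit [DecidableEq V] in
/-- The outer vertices of `u, v, w`: adjacent to none of them. -/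
def outer (D : SimpleGraph V) [DecidableRel D.Adj] (u v w : V) : Finset V :=
  univ.filter (fun x => ¬ D.Adj u x ∧ ¬ D.Adj v x ∧ ¬ D.Adj w x)

omit [DecidableEq V] in
/-- Membership in `priv`. -/
theorem mem_priv (D : SimpleGraph V) [DecidableRel D.Adj] (a b c x : V) :
    x ∈ priv D a b c ↔ D.Adj a x ∧ ¬ D.Adj b x ∧ ¬ D.Adj c x := by
  simp only [priv, mem_filter, mem_univ, true_and]

omit [DecidableEq V] in
/-- Membership in `outer`. -/
theorem mem_outer (D : SimpleGraph V) [DecidableRel D.Adj] (u v w x : V) :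
    x ∈ outer D u v w ↔ ¬ D.Adj u x ∧ ¬ D.Adj v x ∧ ¬ D.Adj w x := by
  simp only [outer, mem_filter, mem_univ, true_and]

omit [DecidableEq V] in
/-- `priv` is symmetric in its last two arguments. -/
theorem priv_comm (D : SimpleGraph V) [DecidableRel D.Adj] (a b c : V) : priv D a b c = priv D a c b := by
  ext x
  rw [mem_priv, mem_priv]
  tauto

/-- In a `K₄⁻`-free graph a neighbour of `u` other than `v, w` in a triangle `u v w` is a private neighbour. -/
theorem mem_priv_of_adj (D : SimpleGraph V) [DecidableRel D.Adj] (hK : K4mFree D) {u v w : V}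
    (huv : D.Adj u v) (huw : D.Adj u w) (hvw : D.Adj v w) {x : V} (hux : D.Adj u x) (hxv : x ≠ v)
    (hxw : x ≠ w) : x ∈ priv D u v w := by
  rw [mem_priv]
  refine ⟨hux, fun hvx => ?_, fun hwx => ?_⟩
  · exact not_adj_both D hK huv huw hvw (Ne.symm hxw) hux hvx
  · exact not_adj_both D hK huw huv hvw.symm (Ne.symm hxv) hux hwx

/-- Around a triangle `u v w` of a `K₄⁻`-free graph every other vertex lies in exactly one of
`priv u`, `priv v`, `priv w`, `outer`: the cardinalities add up to `k − 3`. -/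
theorem card_partition_triangle (D : SimpleGraph V) [DecidableRel D.Adj] (hK : K4mFree D) {u v w : V}
    (huv : D.Adj u v) (huw : D.Adj u w) (hvw : D.Adj v w) :
    (priv D u v w).card + (priv D v u w).card + (priv D w u v).card + (outer D u v w).card + 3 =
      Fintype.card V := by
  have key : ∀ x : V, (if x = u then 1 else 0) + (if x = v then 1 else 0) + (if x = w then 1 else 0) +
      (if x ∈ priv D u v w then 1 else 0) + (if x ∈ priv D v u w then 1 else 0) +
      (if x ∈ priv D w u v then 1 else 0) + (if x ∈ outer D u v w then 1 else 0) = 1 := by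
    intro x
    have huv' := huv.ne
    have huw' := huw.ne
    have hvw' := hvw.ne
    by_cases hxu : x = u
    · subst hxu
      have h1 : x ∉ priv D x v w := by rw [mem_priv]; exact fun h => h.1.ne rfl
      have h2 : x ∉ priv D v x w := by rw [mem_priv]; exact fun h => h.2.2 huw.symm
      have h3 : x ∉ priv D w x v := by rw [mem_priv]; exact fun h => h.2.2 huv.symm
      have h4 : x ∉ outer D x v w := by rw [mem_outer]; exact fun h => h.2.1 huv.symm
      simp [h1, h2, h3, h4, huv', huw']
    by_cases hxv : x = v
    · subst hxv
      have h1 : x ∉ priv D u x w := by rw [mem_priv]; exact fun h => h.2.2 hvw.symm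
      have h2 : x ∉ priv D x u w := by rw [mem_priv]; exact fun h => h.1.ne rfl
      have h3 : x ∉ priv D w u x := by rw [mem_priv]; exact fun h => h.2.1 huv
      have h4 : x ∉ outer D u x w := by rw [mem_outer]; exact fun h => h.1 huv
      simp [h1, h2, h3, h4, hxu, hvw']
    by_cases hxw : x = w
    · subst hxw
      have h1 : x ∉ priv D u v x := by rw [mem_priv]; exact fun h => h.2.1 hvw
      have h2 : x ∉ priv D v u x := by rw [mem_priv]; exact fun h => h.2.1 huw
      have h3 : x ∉ priv D x u v := by rw [mem_priv]; exact fun h => h.1.ne rfl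
      have h4 : x ∉ outer D u v x := by rw [mem_outer]; exact fun h => h.1 huw
      simp [h1, h2, h3, h4, hxu, hxv]
    simp only [if_neg hxu, if_neg hxv, if_neg hxw, zero_add, mem_priv, mem_outer]
    by_cases hu : D.Adj u x <;> by_cases hv : D.Adj v x <;> by_cases hw : D.Adj w x
    · exact (not_adj_both D hK huv huw hvw (Ne.symm hxw) hu hv).elim
    · exact (not_adj_both D hK huv huw hvw (Ne.symm hxw) hu hv).elim
    · exact (not_adj_both D hK huw huv hvw.symm (Ne.symm hxv) hu hw).elim
    · simp [hu, hv, hw]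
    · exact (not_adj_both D hK hvw huv.symm huw.symm (Ne.symm hxu) hv hw).elim
    · simp [hu, hv, hw]
    · simp [hu, hv, hw]
    · simp [hu, hv, hw]
  have hsum : ∑ x : V, ((if x = u then 1 else 0) + (if x = v then 1 else 0) + (if x = w then 1 else 0) +
      (if x ∈ priv D u v w then 1 else 0) + (if x ∈ priv D v u w then 1 else 0) +
      (if x ∈ priv D w u v then 1 else 0) + (if x ∈ outer D u v w then 1 else 0)) = ∑ x : V, (1 : ℕ) :=
    sum_congr rfl (fun x _ => key x)
  simp only [sum_add_distrib, sum_ite_eq', mem_univ, if_true, sum_boole, Nat.cast_id,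
    sum_const, card_univ, smul_eq_mul, mul_one] at hsum
  have e1 : univ.filter (fun x => x ∈ priv D u v w) = priv D u v w := by ext x; simp
  have e2 : univ.filter (fun x => x ∈ priv D v u w) = priv D v u w := by ext x; simp
  have e3 : univ.filter (fun x => x ∈ priv D w u v) = priv D w u v := by ext x; simp
  have e4 : univ.filter (fun x => x ∈ outer D u v w) = outer D u v w := by ext x; simp
  rw [e1, e2, e3, e4] at hsum
  omega

/-- If every triangle vertex lies in `{u, v, w}`, there are at most `6` ordered triangles. -/
theorem card_triangles3_le_six (D : SimpleGraph V) [DecidableRel D.Adj] {u v w : V}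
    (hT : ∀ a b c, D.Adj a b → D.Adj a c → D.Adj b c → a = u ∨ a = v ∨ a = w) :
    (triangles3 D).card ≤ 6 := by
  have hsub : triangles3 D ⊆ {((u, v), w), ((v, w), u), ((w, u), v), ((v, u), w), ((u, w), v),
      ((w, v), u)} := by
    intro t ht
    rw [mem_triangles3] at ht
    obtain ⟨hab, hac, hbc⟩ := ht
    have ha := hT _ _ _ hab hac hbc
    have hb := hT _ _ _ hab.symm hbc hac
    have hc := hT _ _ _ hac.symm hbc.symm hab
    obtain ⟨⟨a, b⟩, c⟩ := t
    simp only at hab hac hbc ha hb hc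
    rcases ha with rfl | rfl | rfl <;> rcases hb with rfl | rfl | rfl <;> rcases hc with rfl | rfl | rfl <;>
      first
      | exact (hab.ne rfl).elim
      | exact (hac.ne rfl).elim
      | exact (hbc.ne rfl).elim
      | simp
  exact le_trans (card_le_card hsub) card_le_six

end C047

end TriangleCap

end PercRepro
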